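import Summits.MatrixMultiplication.OmegaCensus.BoxBadSmallGroups2

/-!
# ω-census, family (b3): conjecture C9 — the dihedral quotient maps `D_{2n} ↠ D_{2m}` (`m ∣ n`) and a product of two USEFUL groups that is USELESS: `D_8 × S_3 ⊇ D_24`

HONEST FRAMING (pub-omega census; verbatim): lottery ticket; floor = certified bounds/negative ranges.
Census BOOKKEEPING (conjecture C9 of the cell; pub-omega stpp-1 gen 18):
* `dihedralCastHom h : DihedralGroup n →* DihedralGroup m` for `m ∣ n` (`r_i ↦ r_{i mod m}`, `sr_i ↦ sr_{i mod m}`), surjective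
  — the quotient companion of `dihedralMulHom` (`BoxUsefulDihedral`); with `not_boxUseful_of_surjective` it lifts box-uselessness
  from `D_{2m}` to `D_{2n}` along quotients as well;
* **the four C9 classes are not closed under direct products, in the kernel:** `D_8 = DihedralGroup 4` (centre index `4`) and
  `S_3 = DihedralGroup 3` (centre index `6`) are box-useful (`BoxUsefulDihedral.boxUseful_dihedral_four/three`), but
  `DihedralGroup 4 × DihedralGroup 3` CONTAINS `D_24 = DihedralGroup 12` — the CRT embedding
  `(dihedralCastHom (4 ∣ 12)).prod (dihedralCastHom (3 ∣ 12))`, injective by `decide` — and `D_24` is a kernel BAD group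
  (`BoxBadSmallGroups2.not_boxUseful_of_injective_dihedral12`), so `not_boxUseful_dihedral4_prod_dihedral3 :
  ¬ BoxUseful (DihedralGroup 4 × DihedralGroup 3)` (order `48`, centre index `24`; one of the P-035 forced rows, now by structure).
  This is what C9 (b) predicts: `[G:Z] = 24` is not a class.
Nothing here is progress on `ω`.
-/

namespace Summit.MatrixMultiplication.OmegaCensus

open Finset ProductBoxBound DihedralGroup

/-- **The quotient map `D_{2n} ↠ D_{2m}` for `m ∣ n`**: exponents reduced mod `m`. [folklore] -/
def dihedralCastHom {n m : ℕ} (h : m ∣ n) : DihedralGroup n →* DihedralGroup m where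
  toFun g := match g with
    | r i => r (ZMod.castHom h (ZMod m) i)
    | sr i => sr (ZMod.castHom h (ZMod m) i)
  map_one' := by
    show r (ZMod.castHom h (ZMod m) 0) = 1
    rw [map_zero, one_def]
  map_mul' a b := by
    rcases a with a | a <;> rcases b with b | b
    · show r (ZMod.castHom h (ZMod m) (a + b)) = r _ * r _
      rw [r_mul_r, map_add]
    · show sr (ZMod.castHom h (ZMod m) (b - a)) = r _ * sr _
      rw [r_mul_sr, map_sub]
    · show sr (ZMod.castHom h (ZMod m) (a + b)) = sr _ * r _
      rw [sr_mul_r, map_add]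
    · show r (ZMod.castHom h (ZMod m) (b - a)) = sr _ * sr _
      rw [sr_mul_sr, map_sub]

/-- The quotient map is surjective. [folklore] -/
theorem dihedralCastHom_surjective {n m : ℕ} (h : m ∣ n) : Function.Surjective (dihedralCastHom h) := by
  intro g
  rcases g with k | k
  · obtain ⟨i, hi⟩ := ZMod.castHom_surjective h k
    exact ⟨r i, by show r (ZMod.castHom h (ZMod m) i) = _; rw [hi]⟩
  · obtain ⟨i, hi⟩ := ZMod.castHom_surjective h k
    exact ⟨sr i, by show sr (ZMod.castHom h (ZMod m) i) = _; rw [hi]⟩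

/-- `m ∣ n`, `D_{2m}` box-useless (by an explicit witness count) ⇒ `D_{2n}` box-useless, along the quotient. [folklore] -/
theorem not_boxUseful_dihedral_of_dvd_quot {n m : ℕ} [NeZero n] [NeZero m] (h : m ∣ n)
    {Y W : Finset (DihedralGroup m)} (hY : #Y = 3) (hW : #W = 3) {I : Finset (DihedralGroup m × DihedralGroup m × DihedralGroup m)}
    (hI : I ⊆ univ ×ˢ (Y ×ˢ W)) (hind : ∀ P ∈ I, ∀ P' ∈ I, P ≠ P' → cellWord P P' ≠ 1)
    (hbig : 9 * Fintype.card (DihedralGroup m) ≤ 5 * #I) : ¬ BoxUseful (DihedralGroup n) :=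
  not_boxUseful_of_surjective (dihedralCastHom h) (dihedralCastHom_surjective h) hY hW hI hind hbig

/-- **The CRT embedding `D_24 ↪ D_8 × S_3`**: `r_i ↦ (r_{i mod 4}, r_{i mod 3})`, `sr_i ↦ (sr_{i mod 4}, sr_{i mod 3})`. [folklore] -/
def dihedral12ToProd : DihedralGroup 12 →* DihedralGroup 4 × DihedralGroup 3 :=
  (dihedralCastHom (show 4 ∣ 12 by norm_num)).prod (dihedralCastHom (show 3 ∣ 12 by norm_num))

/-- The CRT embedding is injective (`decide` over the `24²` pairs). [folklore] -/
theorem dihedral12ToProd_injective : Function.Injective dihedral12ToProd := by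
  intro a b
  revert a b
  decide

/-- **`D_8 × S_3 = DihedralGroup 4 × DihedralGroup 3` is NOT box-useful** (it contains `D_24`), although both factors are (centre
index `4` and `6`): the four C9 classes are not closed under direct products. [folklore] -/
theorem not_boxUseful_dihedral4_prod_dihedral3 : ¬ BoxUseful (DihedralGroup 4 × DihedralGroup 3) :=
  not_boxUseful_of_injective_dihedral12 dihedral12ToProd dihedral12ToProd_injective

end Summit.MatrixMultiplication.OmegaCensus
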